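import Mathlib
import Summits.AnomalousDissipation.AnomalousDissipation.Theorems.SoloBlindGPUniqueness

/-!
# Non-degeneracy of the positive Thomas–Fermi-class Gross–Pitaevskii pattern (discrete)

Companion to `SoloBlindGPUniqueness` (solo-blind paper §24.17(7)(h), second theorem).  At a positive
solution `A` of the discrete GP equation `ε² ΔA + b A − A·T[A²] = 0` on the cycle `ZMod N`, the
linearised operator

  `L φ = ε² Δφ + (b − T[A²]) φ − 2 A · T[A φ]`

is injective, provided `T` is monotone with form-kernel the constants and `A` is not a constant state.
Mechanism: the Schrödinger part `H = ε²Δ + (b − T[A²])` annihilates the positive vector `A`, so by the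
discrete ground-state (Doob) identity `⟨φ, Hφ⟩ = −ε² Σ AᵢAᵢ₊₁ (φᵢ/Aᵢ − φᵢ₊₁/Aᵢ₊₁)² ≤ 0`, while the
interaction part contributes `−2⟨Aφ, T(Aφ)⟩ ≤ 0`; if `Lφ = 0` both vanish, forcing `φ = κA` and
`κA²` constant, hence `κ = 0`.  This is the implicit-function-theorem hypothesis behind the
ε-persistence of the finite-n pattern (step R4b).  Finite-dimensional algebra only.
-/

namespace Summit.AnomalousDissipation.AnomalousDissipation.Theorems

open Matrix Finset

/-- **Discrete ground-state identity.** If `A` has no zeros, then for every `φ`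
`Σ φᵢ (ε² Δφᵢ − ε² (ΔAᵢ/Aᵢ) φᵢ) = −ε² Σ Aᵢ Aᵢ₊₁ (φᵢ/Aᵢ − φᵢ₊₁/Aᵢ₊₁)²`. -/
theorem groundState_form_eq {N : ℕ} [NeZero N] (A φ : ZMod N → ℝ) (hA : ∀ i, A i ≠ 0) (ε : ℝ) :
    ∑ i, φ i * (ε ^ 2 * lapZ φ i - ε ^ 2 * (lapZ A i / A i) * φ i)
      = -ε ^ 2 * ∑ i, A i * A (i + 1) * (φ i / A i - φ (i + 1) / A (i + 1)) ^ 2 := by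
  -- node term = f i + g (i - 1) with f, g the two halves of the edge term
  set f : ZMod N → ℝ := fun i => ε ^ 2 * (φ i * φ (i + 1) - φ i ^ 2 * A (i + 1) / A i) with hf
  set g : ZMod N → ℝ := fun i => ε ^ 2 * (φ (i + 1) * φ i - φ (i + 1) ^ 2 * A i / A (i + 1)) with hg
  have hterm : ∀ i, φ i * (ε ^ 2 * lapZ φ i - ε ^ 2 * (lapZ A i / A i) * φ i) = f i + g (i - 1) := by
    intro i
    simp only [hf, hg, lapZ, sub_add_cancel]
    have ha := hA i
    field_simp
    ring
  have hedge : ∀ i, -ε ^ 2 * (A i * A (i + 1) * (φ i / A i - φ (i + 1) / A (i + 1)) ^ 2) = f i + g i := by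
    intro i
    simp only [hf, hg]
    have ha := hA i; have hb := hA (i + 1)
    field_simp
    ring
  rw [Finset.sum_congr rfl (fun i _ => hterm i), Finset.mul_sum,
    Finset.sum_congr rfl (fun i _ => hedge i), Finset.sum_add_distrib, Finset.sum_add_distrib]
  congr 1
  exact Fintype.sum_equiv (Equiv.subRight (1 : ZMod N)) _ _ (fun i => rfl)

/-- The ground-state form is nonpositive when `A > 0`. -/
theorem groundState_form_nonpos {N : ℕ} [NeZero N] (A φ : ZMod N → ℝ) (hA : ∀ i, 0 < A i) (ε : ℝ) :
    ∑ i, φ i * (ε ^ 2 * lapZ φ i - ε ^ 2 * (lapZ A i / A i) * φ i) ≤ 0 := by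
  rw [groundState_form_eq A φ (fun i => (hA i).ne') ε]
  have : 0 ≤ ∑ i, A i * A (i + 1) * (φ i / A i - φ (i + 1) / A (i + 1)) ^ 2 :=
    Finset.sum_nonneg fun i _ => by have := hA i; have := hA (i + 1); positivity
  nlinarith [sq_nonneg ε]

/-- **Non-degeneracy of the positive pattern (discrete R4b, second half).**  At a positive,
non-constant solution of the discrete GP equation with monotone `T` (form-kernel = constants) and
`ε ≠ 0`, the linearised operator `L φ = ε² Δφ + (b − T[A²]) φ − 2A·T[Aφ]` has trivial kernel. -/
theorem gp_linearisation_injective {N : ℕ} [NeZero N] (T : Matrix (ZMod N) (ZMod N) ℝ)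
    (b : ZMod N → ℝ) (ε : ℝ) (hε : ε ≠ 0)
    (hpsd : ∀ v : ZMod N → ℝ, 0 ≤ v ⬝ᵥ (T *ᵥ v))
    (hker : ∀ v : ZMod N → ℝ, v ⬝ᵥ (T *ᵥ v) = 0 → ∃ c : ℝ, ∀ i, v i = c)
    (A : ZMod N → ℝ) (hA : IsGPSolution T b ε A) (hnc : ∃ i, A i ≠ A 0)
    (φ : ZMod N → ℝ)
    (hL : ∀ i, ε ^ 2 * lapZ φ i + (b i - (T *ᵥ (fun j => A j ^ 2)) i) * φ i
      - 2 * A i * (T *ᵥ (fun j => A j * φ j)) i = 0) :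
    φ = 0 := by
  have hA0 : ∀ i, A i ≠ 0 := fun i => (hA.pos i).ne'
  -- the potential b - T[A²] equals -ε² ΔA/A (ground state)
  have hV : ∀ i, b i - (T *ᵥ (fun j => A j ^ 2)) i = -(ε ^ 2 * (lapZ A i / A i)) := by
    intro i
    have h := hA.eqn i
    have ha := hA0 i
    field_simp
    linarith [h]
  -- pair the equation with φ and split into the two nonpositive forms
  set G := ∑ i, φ i * (ε ^ 2 * lapZ φ i - ε ^ 2 * (lapZ A i / A i) * φ i) with hGdef
  set ψ : ZMod N → ℝ := fun j => A j * φ j with hψ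
  have hsum : G - 2 * (ψ ⬝ᵥ (T *ᵥ ψ)) = 0 := by
    have h0 : ∑ i, φ i * (ε ^ 2 * lapZ φ i + (b i - (T *ᵥ (fun j => A j ^ 2)) i) * φ i
        - 2 * A i * (T *ᵥ (fun j => A j * φ j)) i) = 0 :=
      Finset.sum_eq_zero fun i _ => by rw [hL i, mul_zero]
    have h1 : ∑ i, φ i * (ε ^ 2 * lapZ φ i + (b i - (T *ᵥ (fun j => A j ^ 2)) i) * φ i
        - 2 * A i * (T *ᵥ (fun j => A j * φ j)) i)
        = G - 2 * (ψ ⬝ᵥ (T *ᵥ ψ)) := by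
      rw [hGdef, hψ]
      unfold dotProduct
      rw [Finset.mul_sum, ← Finset.sum_sub_distrib]
      refine Finset.sum_congr rfl fun i _ => ?_
      rw [hV i]
      ring
    rw [← h1]; exact h0
  have hG : G ≤ 0 := groundState_form_nonpos A φ hA.pos ε
  have hP : 0 ≤ ψ ⬝ᵥ (T *ᵥ ψ) := hpsd ψ
  have hG0 : G = 0 := by linarith
  have hP0 : ψ ⬝ᵥ (T *ᵥ ψ) = 0 := by linarith
  -- (i) Aφ is a constant vector
  obtain ⟨c, hc⟩ := hker ψ hP0
  -- (ii) φ/A is constant around the cycle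
  have hsq : ∑ i, A i * A (i + 1) * (φ i / A i - φ (i + 1) / A (i + 1)) ^ 2 = 0 := by
    have := groundState_form_eq A φ hA0 ε
    rw [← hGdef, hG0] at this
    have hε2 : (0 : ℝ) < ε ^ 2 := by positivity
    nlinarith
  have hterms : ∀ i, A i * A (i + 1) * (φ i / A i - φ (i + 1) / A (i + 1)) ^ 2 = 0 := fun i =>
    (Finset.sum_eq_zero_iff_of_nonneg (fun j _ => by
      have := hA.pos j; have := hA.pos (j + 1); positivity)).mp hsq i (Finset.mem_univ i)
  have hratio : ∀ i, φ i / A i = φ 0 / A 0 := by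
    apply const_of_succ_eq
    intro i
    have h := hterms i
    have hprod : A i * A (i + 1) ≠ 0 := mul_ne_zero (hA0 i) (hA0 (i + 1))
    rcases mul_eq_zero.mp h with h | h
    · exact absurd h hprod
    · have := pow_eq_zero_iff (n := 2) (by norm_num) |>.mp h
      linarith
  set κ := φ 0 / A 0 with hκ
  have hφ : ∀ i, φ i = κ * A i := by
    intro i
    have := hratio i
    rw [div_eq_iff (hA0 i)] at this
    exact this
  -- (iii) κ A² constant and A non-constant force κ = 0
  obtain ⟨i₁, hi₁⟩ := hnc
  have e1 := hc i₁; have e0 := hc 0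
  simp only [hψ, hφ] at e1 e0
  -- A i₁ * (κ * A i₁) = c = A 0 * (κ * A 0)
  have hk : κ * (A i₁ ^ 2 - A 0 ^ 2) = 0 := by nlinarith
  have hne : A i₁ ^ 2 - A 0 ^ 2 ≠ 0 := by
    intro h
    have hp1 := hA.pos i₁; have hp0 := hA.pos 0
    have : A i₁ = A 0 := by nlinarith
    exact hi₁ this
  have hκ0 : κ = 0 := by
    rcases mul_eq_zero.mp hk with h | h
    · exact h
    · exact absurd h hne
  funext i
  rw [hφ i, hκ0, zero_mul]
  rfl

end Summit.AnomalousDissipation.AnomalousDissipation.Theorems
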